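import Summits.BirchSwinnertonDyer.Rank1Residual.ManinAdditive.KatoShiftTwoLaws
import Summits.BirchSwinnertonDyer.Rank1Residual.ManinConstantOne
import Summits.BirchSwinnertonDyer.BirchSwinnertonDyer.Theses.ManinLocalTwoThree
import Literature.NumberTheory.EllipticCurves.ModularCurveManinConstantProofs
import Literature.NumberTheory.EllipticCurves.GlobalMinimalModel
import HarnessLib
import HarnessLib.Audit.Tags

/-!
# Proved edges for the prime-2 Euler-system leaves of cell `bsd-f2-manin` (E-es-21 / E-es-22 / E-es-23) — the `p = 2`
# twin of `KatoShiftThreeLawsEdges.lean`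

All statements and proofs VERBATIM from the planner's typing source HOME
`run/shared/lean/pub/bsd-f2-manin/es/T-es-10-draft.lean` sha16 a2b03c487931af06 FILE 3 (farm rc 0 · 0 sorries · 0 warnings ·
axioms standard; Line file Line-es-kato-shift-two-reg.lean cf35a6738bf8791d). Nothing conjectural is asserted: the leaves,
the route cruxes and the named facts enter as hypotheses.

* VOCABULARY by name: `genSet N = {8} ∪ {q ∥ N}`, `multiShiftClass`, `multiShiftClassSpan`, `AdmissiblePrimeTwo`
  (curve-free: `ℓ ∤ N` prime, `ℓ ≡ 3 (mod 4)`, no hole generator is `±1 mod ℓ`), `realComponents`; `primeClass` is the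
  landed one (`KatoShiftThreeLawsEdges`); bridge `multiShiftClassGenerationTwo_iff` (`Iff.rfl`).
* PLACEMENT: Manin ⟹ each law; C2 `ManinOddAtFour` (stmt-BirchSwinnertonDyer-22967, with its support bundle
  `PrintedSemistableManinFacts`) ⟹ each piece.
* THE SPLIT (E-es-23) BY NAME: `maninOddAtFour_of_katoShift_of_residuals` :
  `KatoShiftTwistManinTwo → ManinOddOfPosDiscAtFour → ManinOddOfReducibleAtFour → ManinOddAtFour`, and
  `maninOddAtFour_iff_katoShift_and_residuals (hPF)`.
* THE LEVER with the Line's two PROVED lemmas (`additive_of_four_dvd_level`, `functional_nonvanishing_gen_re`) and the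
  composition `katoShiftTwistManinTwo_of_shiftStep` : (ES-step with holes — the CONCLUSION of the Line's registered stub
  `stub_two_dvd_multiShiftClass`, itself granted the tree fact `kato_neron_isIntegral_twistedSymbolSum_of_additive_two_polar`)
  → `MultiShiftClassGenerationTwo` → `KatoShiftTwistManinTwo`.
-/

noncomputable section

open scoped BigOperators MatrixGroups ModularForm Classical

open CongruenceSubgroup WeierstrassCurve
  Literature.NumberTheory.EllipticCurves Literature.NumberTheory.EllipticCurves.ModularForms
  Summit.BirchSwinnertonDyer.Rank1Residual.ManinConstant
  Summit.BirchSwinnertonDyer.BirchSwinnertonDyer.Theses.ManinLocalTwoThree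

set_option autoImplicit false

namespace Summit.BirchSwinnertonDyer.Rank1Residual.ManinAdditive

/-! ### 1. Vocabulary (Line file §1; `primeClass` is the landed one of `KatoShiftThreeLawsEdges`) and the bridge -/

/-- The HOLE GENERATORS `Gen(N) = {8} ∪ {q prime : q ∥ N}`. -/
def genSet (N : ℕ) : Finset ℕ :=
  insert 8 (N.primeFactors.filter fun q => ¬ q ^ 2 ∣ N)

/-- The MULTI-SHIFT CLASS `Σ_{T ⊆ Gen(N)} (−1)^{|T|} {0, a·∏T/ℓ}_f ∈ Λ_f`. -/
def multiShiftClass {N : ℕ} (f : CuspForm (Gamma0 N) 2) (ℓ a : ℕ) : ℂ :=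
  ∑ T ∈ (genSet N).powerset, (-1 : ℂ) ^ T.card * primeClass f ℓ (a * ∏ t ∈ T, t)

/-- The subgroup of `ℂ` generated by the multi-shift classes at the primes of `S`. -/
def multiShiftClassSpan {N : ℕ} (f : CuspForm (Gamma0 N) 2) (S : Set ℕ) : AddSubgroup ℂ :=
  AddSubgroup.closure {z : ℂ | ∃ ℓ ∈ S, ∃ a : ℕ, 0 < a ∧ a < ℓ ∧ z = multiShiftClass f ℓ a}

/-- ADMISSIBLE auxiliary prime at `p = 2` (curve-free): `ℓ ∤ N` prime, `ℓ ≡ 3 (mod 4)` (so `(ℤ/ℓ)^×/±1` has odd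
order), and no hole generator is `±1 mod ℓ`. -/
def AdmissiblePrimeTwo (N ℓ : ℕ) : Prop :=
  ℓ.Prime ∧ ¬ ℓ ∣ N ∧ ℓ % 4 = 3 ∧ ∀ t ∈ genSet N, (t : ZMod ℓ) ≠ 1 ∧ (t : ZMod ℓ) ≠ -1

/-- `#π₀(V(ℝ))` for a (globally minimal) model: `2` if `Δ > 0`, else `1`. -/
def realComponents (V : WeierstrassCurve ℚ) : ℕ :=
  if 0 < V.Δ then 2 else 1

/-- **Bridge**: the inlined leaf `MultiShiftClassGenerationTwo` IS the Line's structured statement. -/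
theorem multiShiftClassGenerationTwo_iff :
    MultiShiftClassGenerationTwo ↔
      ∀ (W : WeierstrassCurve ℚ) [W.IsElliptic] {N : ℕ} [NeZero N] (f : CuspForm (Gamma0 N) 2) (ℓ₀ : ℕ),
        IsNewformOf W f → 2 ^ 2 ∣ N → W.HasIrreducibleModPGaloisRep 2 →
        ∃ m : ℕ, ¬ 2 ∣ m ∧ ∀ z ∈ periodLattice f,
          (m : ℂ) * z ∈ multiShiftClassSpan f {ℓ | ℓ₀ ≤ ℓ ∧ AdmissiblePrimeTwo N ℓ} :=
  Iff.rfl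

/-! ### 2. Placement edges: Manin ⟹ each law; the route crux C2 ⟹ each piece -/

/-- **Manin ⟹ E-es-21.** -/
theorem katoShiftTwistManinTwo_of_maninConstantOne (hMC : ManinConstantOne) :
    KatoShiftTwistManinTwo := by
  intro W _ _ N _ D hD _ _
  have h1 : |D.maninConstant| = 1 := hMC W D hD
  refine ⟨fun hdvd => ?_, fun _ hdvd => ?_⟩
  · have h2 : (4 : ℤ) ∣ 1 := h1 ▸ (dvd_abs _ _).mpr hdvd
    omega
  · have h2 : (2 : ℤ) ∣ 1 := h1 ▸ (dvd_abs _ _).mpr hdvd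
    omega

/-- **Manin ⟹ the archimedean residual.** -/
theorem maninOddOfPosDiscAtFour_of_maninConstantOne (hMC : ManinConstantOne) :
    ManinOddOfPosDiscAtFour := by
  intro W _ _ N _ D hD _ _ _ _ hdvd
  have h1 : |D.maninConstant| = 1 := hMC W D hD
  have h2 : (2 : ℤ) ∣ 1 := h1 ▸ (dvd_abs _ _).mpr hdvd
  omega

/-- **Manin ⟹ the 2-torsion residual.** -/
theorem maninOddOfReducibleAtFour_of_maninConstantOne (hMC : ManinConstantOne) :
    ManinOddOfReducibleAtFour := by
  intro W _ _ N _ D hD _ _ hdvd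
  have h1 : |D.maninConstant| = 1 := hMC W D hD
  have h2 : (2 : ℤ) ∣ 1 := h1 ▸ (dvd_abs _ _).mpr hdvd
  omega

/-- **C2 ⟹ E-es-21** (granted the route's support bundle `PrintedSemistableManinFacts`). -/
theorem katoShiftTwistManinTwo_of_C2 (hPF : PrintedSemistableManinFacts) (h2 : ManinOddAtFour) :
    KatoShiftTwistManinTwo := by
  obtain ⟨hM, hAU, hC, hnf⟩ := hPF
  intro W _ _ N _ D hD h4 _
  have hodd : ¬ (2 : ℤ) ∣ D.c := h2 hM hAU hC hnf W D hD h4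
  exact ⟨fun h4c => hodd (dvd_trans ⟨2, by norm_num⟩ h4c), fun _ => hodd⟩

/-- **C2 ⟹ the archimedean residual.** -/
theorem maninOddOfPosDiscAtFour_of_C2 (hPF : PrintedSemistableManinFacts) (h2 : ManinOddAtFour) :
    ManinOddOfPosDiscAtFour := by
  obtain ⟨hM, hAU, hC, hnf⟩ := hPF
  intro W _ _ N _ D hD h4 _ _ _
  exact h2 hM hAU hC hnf W D hD h4

/-- **C2 ⟹ the 2-torsion residual.** -/
theorem maninOddOfReducibleAtFour_of_C2 (hPF : PrintedSemistableManinFacts) (h2 : ManinOddAtFour) :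
    ManinOddOfReducibleAtFour := by
  obtain ⟨hM, hAU, hC, hnf⟩ := hPF
  intro W _ _ N _ D hD h4 _
  exact h2 hM hAU hC hnf W D hD h4

/-! ### 3. The split (E-es-23) BY NAME: C2 ⟸ E-es-21 ∧ archimedean residual ∧ 2-torsion residual -/

/-- **C2 ⟸ E-es-21 ∧ residuals** — concluding the route decl
`Summit.BirchSwinnertonDyer.BirchSwinnertonDyer.Theses.ManinLocalTwoThree.ManinOddAtFour` (stmt-BirchSwinnertonDyer-22967)
BY NAME; the crux's four fact binders are discarded; `Δ = 0` is excluded by `W.isUnit_Δ`. -/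
theorem maninOddAtFour_of_katoShift_of_residuals
    (hA : KatoShiftTwistManinTwo) (hR : ManinOddOfPosDiscAtFour) (hB : ManinOddOfReducibleAtFour) :
    ManinOddAtFour := by
  intro _hMazur _hAbbesUllmo _hCesnavicius _hnf W _ _ N _ D hopt h4
  show ¬ (2 : ℤ) ∣ D.c
  by_cases hirr : W.HasIrreducibleModPGaloisRep 2
  · obtain ⟨h4c, hneg⟩ := hA W D hopt h4 hirr
    rcases lt_trichotomy W.Δ 0 with hlt | heq | hgt
    · exact hneg hlt
    · exact absurd heq W.isUnit_Δ.ne_zero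
    · exact hR W D hopt h4 hirr hgt h4c
  · exact hB W D hopt h4 hirr

/-- **Given the printed facts, C2 ⟺ (E-es-21 ∧ archimedean residual ∧ 2-torsion residual).** -/
theorem maninOddAtFour_iff_katoShift_and_residuals (hPF : PrintedSemistableManinFacts) :
    ManinOddAtFour ↔ (KatoShiftTwistManinTwo ∧ ManinOddOfPosDiscAtFour ∧ ManinOddOfReducibleAtFour) :=
  ⟨fun h2 => ⟨katoShiftTwistManinTwo_of_C2 hPF h2, maninOddOfPosDiscAtFour_of_C2 hPF h2,
      maninOddOfReducibleAtFour_of_C2 hPF h2⟩,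
    fun h => maninOddAtFour_of_katoShift_of_residuals h.1 h.2.1 h.2.2⟩

/-! ### 4. The lever: E-es-21 ⟸ (ES-step with holes) ∧ E-es-22, with the Line's two PROVED lemmas -/

/-- `additive_of_four_dvd_level` — LEVEL-TO-LOCAL GLUE, PROVED (Line file, es g7; UNCONDITIONAL). -/
theorem additive_of_four_dvd_level :
    ∀ (W : WeierstrassCurve ℚ) [W.IsElliptic] {N : ℕ} [NeZero N] (f : CuspForm (Gamma0 N) 2),
      IsNewformOf W f → 2 ^ 2 ∣ N →
      ¬ W.HasGoodReductionAtPrime 2 ∧ ¬ W.HasMultiplicativeReductionAtPrime 2 := by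
  intro W _ N _ f hf h4
  haveI : Fact (Nat.Prime 2) := ⟨Nat.prime_two⟩
  have h2N : 2 ∣ N := dvd_trans (dvd_pow_self 2 two_ne_zero) h4
  refine ⟨fun hgood => ?_, fun hmult => ?_⟩
  · have h2c : 2 ∣ W.conductorNorm ℤ := (hf.dvd_level_iff_dvd_conductorNorm Nat.prime_two).mp h2N
    exact (W.dvd_conductorNorm_iff_not_hasGoodReductionAtPrime 2).mp h2c hgood
  · exact SkinnerUrban2014.not_sq_dvd_level_of_hasMultiplicativeReductionAtPrime hmult hf h4

/-- `functional_nonvanishing_gen_re` — THE LATTICE-UNIT PUNCHLINE ON THE REAL SIDE, PROVED (Line file, es g7):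
`re/(Ω⁺_f/2)` is onto `ℤ` on `Λ_f`, so it is not even on a generating set of `mΛ_f`, `m` odd. -/
theorem functional_nonvanishing_gen_re {N : ℕ} [NeZero N] (f : CuspForm (Gamma0 N) 2) (T : Set ℂ) (m : ℕ)
    (hm : ¬ 2 ∣ m) (hpos : 0 < plusPeriod f)
    (hspan : ∀ z ∈ periodLattice f, (m : ℂ) * z ∈ AddSubgroup.closure T)
    (hT : ∀ t ∈ T, ∃ n : ℤ, t.re = 2 * n * (plusPeriod f / 2)) : False := by
  classical
  have key : ∃ Ω : ℝ, 0 < Ω ∧ realPeriods f = AddSubgroup.zmultiples (Ω / 2) := by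
    by_contra h
    have : plusPeriod f = 0 := by unfold plusPeriod; rw [dif_neg h]
    linarith
  have hdef : plusPeriod f = key.choose := by unfold plusPeriod; rw [dif_pos key]
  have hΩ : realPeriods f = AddSubgroup.zmultiples (plusPeriod f / 2) := by
    rw [hdef]; exact key.choose_spec.2
  have hmem : plusPeriod f / 2 ∈ realPeriods f := by
    rw [hΩ]; exact AddSubgroup.mem_zmultiples _
  obtain ⟨z, hz, hzre⟩ := AddSubgroup.mem_map.mp hmem
  have hzre' : z.re = plusPeriod f / 2 := by simpa using hzre
  have hcl : ∀ w ∈ AddSubgroup.closure T, ∃ n : ℤ, w.re = 2 * n * (plusPeriod f / 2) := by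
    intro w hw
    induction hw using AddSubgroup.closure_induction with
    | mem x hx => exact hT x hx
    | zero => exact ⟨0, by simp⟩
    | add x y _ _ ihx ihy =>
      obtain ⟨a, ha⟩ := ihx
      obtain ⟨b, hb⟩ := ihy
      exact ⟨a + b, by rw [Complex.add_re, ha, hb]; push_cast; ring⟩
    | neg x _ ih =>
      obtain ⟨a, ha⟩ := ih
      exact ⟨-a, by rw [Complex.neg_re, ha]; push_cast; ring⟩
  obtain ⟨n, hn⟩ := hcl _ (hspan z hz)
  have h1 : ((m : ℂ) * z).re = (m : ℝ) * (plusPeriod f / 2) := by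
    rw [Complex.mul_re]; simp [hzre']
  have h2 : (m : ℝ) * (plusPeriod f / 2) = 2 * n * (plusPeriod f / 2) := by rw [← h1, hn]
  have hne : plusPeriod f / 2 ≠ 0 := by positivity
  have h3 : (m : ℝ) = 2 * n := mul_right_cancel₀ hne h2
  have h4 : (m : ℤ) = 2 * n := by exact_mod_cast h3
  exact hm (Int.natCast_dvd_natCast.mp ⟨n, by simpa using h4⟩)

/-- **E-es-21 ⟸ (ES-step with holes at `⟨8⟩` and `⟨q⟩, q ∥ N`) ∧ E-es-22.**  `hE` is the Line's
`stub_two_dvd_multiShiftClass` CONCLUSION (itself granted the named fact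
`kato_neron_isIntegral_twistedSymbolSum_of_additive_two_polar`): at a lattice-optimal datum with `4 ∣ N`, `W`
additive at 2, `W[2]` irreducible, `2 ∣ c` and (`Δ < 0` or `4 ∣ c`), every multi-shift class over an admissible prime
has real part in `2ℤ·(Ω⁺_f/2)`; `hG` is the leaf `MultiShiftClassGenerationTwo` (bridge `multiShiftClassGenerationTwo_iff`). -/
theorem katoShiftTwistManinTwo_of_shiftStep
    (hE : ∀ (W : WeierstrassCurve ℚ) [W.IsElliptic] [W.IsGloballyMinimal] {N : ℕ} [NeZero N]
      (D : ModularParametrizationData W N),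
      (∀ z ∈ D.L.lattice, ∃ w ∈ periodLattice D.f, z = D.c * w) → 2 ^ 2 ∣ N →
      ¬ W.HasGoodReductionAtPrime 2 → ¬ W.HasMultiplicativeReductionAtPrime 2 →
      W.HasIrreducibleModPGaloisRep 2 → (2 : ℤ) ∣ D.c → (W.Δ < 0 ∨ (4 : ℤ) ∣ D.c) →
      ∀ ℓ : ℕ, AdmissiblePrimeTwo N ℓ → ∀ a : ℕ, 0 < a → a < ℓ →
        ∃ n : ℤ, (multiShiftClass D.f ℓ a).re = 2 * n * (plusPeriod D.f / 2))
    (hG : MultiShiftClassGenerationTwo) :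
    KatoShiftTwistManinTwo := by
  intro W _ _ N _ D hopt h4 hirr
  obtain ⟨hg, hm⟩ := additive_of_four_dvd_level W D.f D.isNewformOf h4
  obtain ⟨m, hm2, hspan⟩ := (multiShiftClassGenerationTwo_iff.mp hG) W D.f 0 D.isNewformOf h4 hirr
  have hpos : 0 < plusPeriod D.f :=
    IsNewform0.plusPeriod_pos_holds D.isNewformOf.1 D.isNewformOf.coeffField_eq_bot
  have key : (2 : ℤ) ∣ D.c → (W.Δ < 0 ∨ (4 : ℤ) ∣ D.c) → False := by
    intro h2 hside
    refine functional_nonvanishing_gen_re D.f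
      {z | ∃ ℓ ∈ {ℓ | 0 ≤ ℓ ∧ AdmissiblePrimeTwo N ℓ}, ∃ a : ℕ, 0 < a ∧ a < ℓ ∧ z = multiShiftClass D.f ℓ a}
      m hm2 hpos hspan ?_
    rintro t ⟨ℓ, hℓ, a, ha1, ha2, rfl⟩
    exact hE W D hopt h4 hg hm hirr h2 hside ℓ hℓ.2 a ha1 ha2
  refine ⟨fun h4c => ?_, fun hΔ h2c => key h2c (Or.inl hΔ)⟩
  exact key (dvd_trans ⟨2, by norm_num⟩ h4c) (Or.inr h4c)

end Summit.BirchSwinnertonDyer.Rank1Residual.ManinAdditive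

end
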